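import Mathlib
import Summits.QuantumFields.YangMills.Theorems.BalabanUVNodesN15DerivCoefficient
import Summits.QuantumFields.YangMills.Theorems.BalabanUVNodesN15NonlinearCoefficient
import Summits.QuantumFields.YangMills.Theorems.BalabanUVNodesN15KingTorusLine
import HarnessLib

/-!
# Route «BalabanUVNodes» (cluster K4 «SpineRates»), Track-A DAG node N15 = spine estimate NE2, BACKGROUND LAYER — FIRST MISSING
# ESTIMATE, part 12d: THE COEFFICIENT SPECIES ON KING's TORUS CARRIER `blockOf L M : Tor (fine L M) → Tor M` BY PERIODIC PULL-BACK —
# every species fit (S0 field, S1 nonlinear maps, S2 differentiated coefficients) and the (R3) regularity transport of parts 12a–12c,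
# restated VERBATIM on the carrier of the -a side (`kingLine L M μ`), via the covering map `ℤ^d → Π_μ ℤ∕N_μ`

Cell `pub-ymgap`, seat `pub-ymgap-dag-n15-b` (generation g2; FIRST-MISSING-ESTIMATE, HUMAN RULING D-0062; chair R424 venue; ROSTER-D0062
l.26).  `bears_on: R4∕N15`.  Filed `--supports stmt-QuantumFields-19351`.  Imports parts 12b∕12c (hence 12a) of this seat and g0's
`…N15KingTorusLine` (p412650 ✓: `kingLine L M μ`, `unitVec`); the tree's `King1986.TorusBlockForm` (`Tor`, `fine`, `site`, `blockOf`,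
`blockSum`) BY NAME.  This is g0's HANDOFF residue (ii) «`LineData` transport along equivalences + dictionary to `Tor N`» for the coefficient
species: the -a seat's single-scale pieces (n15-a g2∕g3 parts 2–8) live on `blockOf L M : Tor (fine L M) → Tor M`, so the `hfit` binders of
`N15.DerivDefect.hasMaj_coeffPiece` ∕ `hasMaj_comp_idef_zerothOrder_comp` must be met THERE.

THE MECHANISM ([folklore]).  The covering map `qT N : ℤ^d → Tor N`, `x ↦ (x_μ mod N_μ)_μ`, intertwines the block map of the infinite lattice with
King's: `blockOf L M (qT (fine L M) x) = qT M (blockMap L x)` (`blockOf_qT`) and the unit translations (`qT_add_single`); a field `a′` on the fine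
torus pulls back to the periodic field `a′ ∘ qT`, whose block mean (12a) is the pull-back of the torus block mean `blockMeanT a′ = L^{−d}·blockSum a′`
(`blockMean_comp_qT`), and whose difference quotients are the pull-backs of the torus ones (`fdiffN_comp_qT`, `bdiffN_comp_qT`).  Every located
letter on the torus pulls back to the corresponding located letter on `ℤ^d`, every pointwise conclusion descends along the surjection `qT`.
(On a small coarse torus the two blocks `b`, `b + e_μ` of species S2's slab may coincide after wrap-around; the transfer is unaffected.)

CONTENTS.
* §1 `qT`, `qT_apply`, `qT_add`, `qT_add_single`, `qT_add_unit`, `qT_sub_unit`, `qT_surjective`; the modular identity `intCast_mul_add_eq` (`L·a + r ≡ L·(a mod m) + r`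
  in `ℤ∕Lm`); `rem` (the in-block offset as `Fin L`), `qT_fine_eq_site`, **`blockOf_qT`**, `qT_bpt`.
* §2 `blockMeanT L M a′ b = blockSum L M a′ b ∕ L^d` (King's `(Qφ)(b)`); `blockSum_eq_sum_offs`, **`blockMean_comp_qT`**, `fdiffN_comp_qT`,
  `bdiffN_comp_qT`.
* §3 THE SPECIES ON THE TORUS: `fit_blockMeanT` (S0), `fit_fdiffN_blockMeanT` ∕ `fit_bdiffN_blockMeanT` (S2), `fit_phi1_blockMeanT` ∕
  `fit_phi2_blockMeanT` (S1), with `slab_letter_of_torus` ∕ `inBlockBondBound_of_torus` (the torus letters pull back); (R3): `abs_blockMeanT_le`,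
  `abs_fdiffN_blockMeanT_le`.
* §4 DICTIONARY to `kingLine L M μ` (`π = blockOf L M`, `s′ = · + unitVec`, spacing ratio `L`): the torus fits ARE `hfit` binders for
  `D := kingLine L M μ` (`hfit_kingLine_of_pointwise`, `kingLine_shifts`).

HONEST FRAMING ∕ LIMITS.  [folklore] transfer plumbing (modular arithmetic + parts 12a–12c BY NAME); real scalar fields, flat differences, linearised
transport; nothing about any operator of [B9] asserted.  NE2⁺ NOT PRINTED, NOT proved; count-neutral (typed 28∕28; nothing discharged); finite tori at
fixed ε — NOT infinite volume, NOT OS on ℝ⁴, NOT a mass gap, NOT Clay.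
-/

noncomputable section

namespace Summit.QuantumFields.YangMills.BalabanUVNodes.N15.CoefficientSpecies

open Literature.MathematicalPhysics.QuantumFieldTheory.Balaban1983to89
open Literature.MathematicalPhysics.QuantumFieldTheory.Balaban1983to89.T4EtaRateCoeffDefect (InBlockBondBound)
open Literature.MathematicalPhysics.QuantumFieldTheory.Balaban1983to89.B5Prop11Plancherel (Tor fine)
open Literature.MathematicalPhysics.QuantumFieldTheory.King1986.Torus (site blockOf blockOf_site val_site blockSum)
open Literature.MathematicalPhysics.QuantumLattice (blockMap blockBase)
open Literature.Probability.LatticeModels (Site)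
open Summit.QuantumFields.YangMills.BalabanUVNodes.N15.DerivDefect (fdiffN bdiffN fdiffN_apply bdiffN_apply LineData)
open Summit.QuantumFields.YangMills.BalabanUVNodes.N15.KingTorusLine (unitVec kingLine kingLine_π kingLine_s')

variable {d : ℕ}

/-! ## §1 The covering map `ℤ^d → Π_μ ℤ∕N_μ` and the block maps -/

section Covering

/-- THE COVERING MAP `qT N x = (x_μ mod N_μ)_μ` of the multi-period torus by `ℤ^d`. [folklore] -/
def qT (N : Fin d → ℕ) (x : Site d) : Tor N := fun μ => (x μ : ZMod (N μ))

/-- Coordinates of the covering map. [folklore] -/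
@[simp] theorem qT_apply (N : Fin d → ℕ) (x : Site d) (μ : Fin d) : qT N x μ = (x μ : ZMod (N μ)) := rfl

/-- The covering map is additive. [folklore] -/
theorem qT_add (N : Fin d → ℕ) (x y : Site d) : qT N (x + y) = qT N x + qT N y := by
  funext μ; simp [qT]

/-- A translation by `c·e_μ` upstairs is the translation by `c·e_μ` downstairs. [folklore] -/
theorem qT_add_single (N : Fin d → ℕ) (x : Site d) (μ : Fin d) (c : ℤ) :
    qT N (x + Pi.single μ c) = qT N x + Pi.single μ (c : ZMod (N μ)) := by
  funext ν
  simp only [qT_apply, Pi.add_apply, Int.cast_add]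
  by_cases h : ν = μ
  · subst h; simp
  · simp [Pi.single_eq_of_ne h]

/-- Unit steps: `qT (x + e_μ) = qT x + unitVec N μ`. [folklore] -/
theorem qT_add_unit (N : Fin d → ℕ) (x : Site d) (μ : Fin d) :
    qT N (x + Pi.single μ 1) = qT N x + unitVec N μ := by
  rw [qT_add_single]; simp [unitVec]

/-- Unit steps backwards: `qT (x − e_μ) = qT x − unitVec N μ`. [folklore] -/
theorem qT_sub_unit (N : Fin d → ℕ) (x : Site d) (μ : Fin d) :
    qT N (x - Pi.single μ 1) = qT N x - unitVec N μ := by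
  funext ν
  simp only [qT_apply, Pi.sub_apply, Int.cast_sub, unitVec]
  by_cases h : ν = μ
  · subst h; simp
  · simp [Pi.single_eq_of_ne h]

/-- The covering map is onto (lift a residue to its canonical representative). [folklore] -/
theorem qT_surjective (N : Fin d → ℕ) [∀ μ, NeZero (N μ)] : Function.Surjective (qT (d := d) N) := by
  intro y
  refine ⟨fun μ => ((y μ).val : ℤ), funext fun μ => ?_⟩
  simp [qT]

/-- THE MODULAR IDENTITY behind the block dictionary: `L·a + r ≡ L·(a mod m) + r` in `ℤ∕(L·m)`. [folklore] -/
theorem intCast_mul_add_eq (L m : ℕ) (a r : ℤ) :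
    ((L * a + r : ℤ) : ZMod (L * m)) = ((L * (a % m) + r : ℤ) : ZMod (L * m)) := by
  rw [ZMod.intCast_eq_intCast_iff]
  push_cast
  exact ((Int.mod_modEq a m).mul_left'.add_right r).symm

variable (L : ℕ) [NeZero L] (M : Fin d → ℕ) [hM : ∀ μ, NeZero (M μ)]

/-- The in-block offset `x_μ mod L ∈ [0, L)` of a point of `ℤ^d`, as an element of `[0,L)^d`. [folklore] -/
def rem (x : Site d) : Fin d → Fin L := fun μ =>
  ⟨(x μ % (L : ℤ)).toNat, by
    have hL : (0 : ℤ) < L := by exact_mod_cast Nat.pos_of_ne_zero (NeZero.ne L)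
    have h1 := Int.emod_lt_of_pos (x μ) hL
    have h0 := Int.emod_nonneg (x μ) hL.ne'
    omega⟩

/-- THE BLOCK DICTIONARY: the image of `x ∈ ℤ^d` on the fine torus is King's site `L·b + j` with `b` the image of `⌊x∕L⌋` on the coarse torus and
`j = x mod L`. [folklore] -/
theorem qT_fine_eq_site (x : Site d) : qT (fine L M) x = site L M (qT M (blockMap L x)) (rem L x) := by
  funext μ
  have hL : (0 : ℤ) < L := by exact_mod_cast Nat.pos_of_ne_zero (NeZero.ne L)
  have hval : (((qT M (blockMap L x)) μ).val : ℤ) = (x μ / (L : ℤ)) % (M μ : ℤ) := by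
    simp only [qT_apply]
    exact ZMod.val_intCast _
  have hrem : ((rem L x μ : ℕ) : ℤ) = x μ % (L : ℤ) := by
    simp only [rem]
    exact Int.toNat_of_nonneg (Int.emod_nonneg (x μ) hL.ne')
  -- both sides as integer casts into `ℤ∕(L·M_μ)`
  have hsite : (site L M (qT M (blockMap L x)) (rem L x) μ : ZMod (fine L M μ)) =
      (((L : ℤ) * ((x μ / (L : ℤ)) % (M μ : ℤ)) + x μ % (L : ℤ) : ℤ) : ZMod (fine L M μ)) := by
    rw [← hval, ← hrem]
    simp only [site]
    push_cast
    ring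
  have hx : (x μ : ZMod (fine L M μ)) = (((L : ℤ) * (x μ / (L : ℤ)) + x μ % (L : ℤ) : ℤ) : ZMod (fine L M μ)) := by
    congr 1
    have := Int.mul_ediv_add_emod (x μ) (L : ℤ)
    linarith
  rw [qT_apply, hsite, hx]
  exact intCast_mul_add_eq L (M μ) _ _

/-- **THE COVERING MAP INTERTWINES THE BLOCK MAPS**: `blockOf L M ∘ qT (fine L M) = qT M ∘ blockMap L`. [folklore] -/
theorem blockOf_qT (x : Site d) : blockOf L M (qT (fine L M) x) = qT M (blockMap L x) := by
  rw [qT_fine_eq_site, blockOf_site]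

/-- The image of the block point `L·y + t` (`t ∈ {0..L−1}^d`, part 12a's `bpt`) is King's site. [folklore] -/
theorem qT_bpt (y : Site d) {t : Fin d → ℕ} (ht : t ∈ offs d L) :
    qT (fine L M) (bpt L y t) = site L M (qT M y) (fun i => ⟨t i, mem_offs.1 ht i⟩) := by
  rw [qT_fine_eq_site, blockMap_bpt L y ht]
  congr 1
  funext μ
  apply Fin.ext
  have hL : (0 : ℤ) < L := by exact_mod_cast Nat.pos_of_ne_zero (NeZero.ne L)
  have ht' : (t μ : ℤ) < L := by exact_mod_cast mem_offs.1 ht μ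
  simp only [rem, bpt_apply]
  rw [add_comm, Int.add_mul_emod_self_left, Int.emod_eq_of_lt (by positivity) ht', Int.toNat_natCast]

end Covering

/-! ## §2 King's block mean and the periodic pull-back -/

section Periodic

variable (L : ℕ) [NeZero L] (M : Fin d → ℕ) [hM : ∀ μ, NeZero (M μ)]

/-- KING's BLOCK MEAN `(Qφ)(b) = L^{−d} Σ_{y ∈ block b} φ(y)` on the torus carrier (`King1986.Torus.blockSum` BY NAME). [folklore] -/
def blockMeanT (a' : Tor (fine L M) → ℝ) (b : Tor M) : ℝ := blockSum L M a' b / (L : ℝ) ^ d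

omit [NeZero L] in
/-- The offsets `{0..L−1}^d` of part 12a are the images of `[0,L)^d`. [folklore] -/
theorem offs_eq_image : offs d L = (Finset.univ : Finset (Fin d → Fin L)).image fun j i => (j i : ℕ) := by
  ext t
  simp only [mem_offs, Finset.mem_image, Finset.mem_univ, true_and]
  constructor
  · intro h
    exact ⟨fun i => ⟨t i, h i⟩, rfl⟩
  · rintro ⟨j, rfl⟩ i
    exact (j i).isLt

/-- King's block sum as a sum over part 12a's offsets. [folklore] -/
theorem blockSum_eq_sum_offs (a' : Tor (fine L M) → ℝ) (y : Site d) :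
    blockSum L M a' (qT M y) = ∑ t ∈ offs d L, a' (qT (fine L M) (bpt L y t)) := by
  rw [offs_eq_image, Finset.sum_image (fun j _ j' _ h => funext fun i => Fin.ext (congr_fun h i))]
  unfold blockSum
  refine Finset.sum_congr rfl fun j _ => ?_
  rw [qT_bpt L M y (mem_offs.2 fun i => (j i).isLt)]

/-- **THE BLOCK MEAN OF THE PERIODIC PULL-BACK IS THE PULL-BACK OF KING's BLOCK MEAN.** [folklore] -/
theorem blockMean_comp_qT (a' : Tor (fine L M) → ℝ) :
    blockMean L (a' ∘ qT (fine L M)) = blockMeanT L M a' ∘ qT M := by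
  funext y
  simp only [Function.comp_apply, blockMean, blockMeanT, blockSum_eq_sum_offs]

/-- Difference quotients commute with the pull-back: `∇^η_μ(g ∘ qT) = (∇^η_μ g) ∘ qT`. [folklore] -/
theorem fdiffN_comp_qT (N : Fin d → ℕ) (η : ℝ) (μ : Fin d) (g : Tor N → ℝ) :
    fdiffN η (fun w : Site d => w + Pi.single μ 1) (g ∘ qT N) = fdiffN η (fun y : Tor N => y + unitVec N μ) g ∘ qT N := by
  funext x
  simp only [fdiffN_apply, Function.comp_apply, qT_add_unit]

/-- Adjoint quotients commute with the pull-back. [folklore] -/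
theorem bdiffN_comp_qT (N : Fin d → ℕ) (η : ℝ) (μ : Fin d) (g : Tor N → ℝ) :
    bdiffN η (Equiv.addRight (Pi.single μ (1 : ℤ))) (g ∘ qT N) =
      bdiffN η (Equiv.addRight (unitVec N μ)) g ∘ qT N := by
  funext x
  simp only [bdiffN_apply, Function.comp_apply, Equiv.addRight_symm, Equiv.coe_addRight, ← sub_eq_add_neg,
    qT_sub_unit]

end Periodic

/-! ## §3 The coefficient species on the torus carrier -/

section Species

variable (L : ℕ) [NeZero L] (M : Fin d → ℕ) [hM : ∀ μ, NeZero (M μ)]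

/-- SPECIES S0 ON THE TORUS.  Letter: along every fine bond INSIDE a block, `|a′(y′ + e_ν) − a′(y′)| ≤ θ₁(blockOf y′)` (`θ₁ ≥ 0`); conclusion:
`|a′(y′) − blockMeanT a′ (blockOf y′)| ≤ d(L−1)·θ₁(blockOf y′)`. [folklore] -/
theorem fit_blockMeanT {a' : Tor (fine L M) → ℝ} {θ₁ : Tor M → ℝ} (hθ : ∀ b, 0 ≤ θ₁ b)
    (h : ∀ (y' : Tor (fine L M)) (ν : Fin d), blockOf L M (y' + unitVec (fine L M) ν) = blockOf L M y' →
      |a' (y' + unitVec (fine L M) ν) - a' y'| ≤ θ₁ (blockOf L M y'))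
    (y' : Tor (fine L M)) :
    |a' y' - blockMeanT L M a' (blockOf L M y')| ≤ (d : ℝ) * ((L : ℝ) - 1) * θ₁ (blockOf L M y') := by
  have hL : 0 < L := Nat.pos_of_ne_zero (NeZero.ne L)
  obtain ⟨x', rfl⟩ := qT_surjective (fine L M) y'
  have hZ : InBlockBondBound L (a' ∘ qT (fine L M)) (θ₁ ∘ qT M) := by
    intro x ν hblk
    have hb : blockOf L M (qT (fine L M) x + unitVec (fine L M) ν) = blockOf L M (qT (fine L M) x) := by
      rw [← qT_add_unit, blockOf_qT, blockOf_qT, hblk]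
    have := h (qT (fine L M) x) ν hb
    simpa [Function.comp_apply, qT_add_unit, blockOf_qT] using this
  have key := fit_blockMean hL (fun y => hθ (qT M y)) hZ x'
  rw [blockMean_comp_qT] at key
  simpa [blockOf_qT] using key

/-- The pull-back of the species-S2 torus letter is the `ℤ^d` slab letter of part 12b. [folklore] -/
theorem slab_letter_of_torus (μ : Fin d) {g' : Tor (fine L M) → ℝ} {θ₂ : Tor M → ℝ}
    (h : ∀ (b : Tor M) (z' : Tor (fine L M)), (blockOf L M z' = b ∨ blockOf L M z' = b + unitVec M μ) →
      ∀ ν : Fin d, |g' (z' + unitVec (fine L M) ν) - g' z'| ≤ θ₂ b) :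
    ∀ y, ∀ z ∈ slab L y μ, ∀ ν : Fin d,
      |(g' ∘ qT (fine L M)) (z + Pi.single ν 1) - (g' ∘ qT (fine L M)) z| ≤ θ₂ (qT M y) := by
  intro y z hz ν
  have hz' : blockOf L M (qT (fine L M) z) = qT M y ∨ blockOf L M (qT (fine L M) z) = qT M y + unitVec M μ := by
    rcases hz with h0 | h1
    · left; rw [blockOf_qT, h0]
    · right; rw [blockOf_qT, h1, qT_add_unit]
  simpa [Function.comp_apply, qT_add_unit] using h (qT M y) (qT (fine L M) z) hz' ν

/-- SPECIES S2 ON THE TORUS, FORWARD QUOTIENT (`Lη′ = η`).  Letter: the unit differences of the fine derivative `∇^{η′}_μ a′` are `≤ θ₂(b)` on the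
bonds starting in `block(b) ∪ block(b + e_μ)`; conclusion: `|∇^{η′}_μ a′(y′) − ∇^η_μ(blockMeanT a′)(blockOf y′)| ≤ (d+1)(L−1)·θ₂(blockOf y′)`. [folklore] -/
theorem fit_fdiffN_blockMeanT (μ : Fin d) {η η' : ℝ} (hLη : (L : ℝ) * η' = η) {a' : Tor (fine L M) → ℝ} {θ₂ : Tor M → ℝ}
    (h : ∀ (b : Tor M) (z' : Tor (fine L M)), (blockOf L M z' = b ∨ blockOf L M z' = b + unitVec M μ) → ∀ ν : Fin d,
      |fdiffN η' (fun y => y + unitVec (fine L M) μ) a' (z' + unitVec (fine L M) ν) -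
        fdiffN η' (fun y => y + unitVec (fine L M) μ) a' z'| ≤ θ₂ b)
    (y' : Tor (fine L M)) :
    |fdiffN η' (fun y => y + unitVec (fine L M) μ) a' y' -
        fdiffN η (fun b => b + unitVec M μ) (blockMeanT L M a') (blockOf L M y')|
      ≤ ((d : ℝ) + 1) * ((L : ℝ) - 1) * θ₂ (blockOf L M y') := by
  have hL : 0 < L := Nat.pos_of_ne_zero (NeZero.ne L)
  obtain ⟨x', rfl⟩ := qT_surjective (fine L M) y'
  have hZ := slab_letter_of_torus L M μ h
  rw [← fdiffN_comp_qT] at hZ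
  have key := fit_fdiffN_blockMean hL μ hLη (a' := a' ∘ qT (fine L M)) (θ₂ := θ₂ ∘ qT M) hZ x'
  rw [fdiffN_comp_qT, blockMean_comp_qT, fdiffN_comp_qT] at key
  simpa [blockOf_qT] using key

/-- SPECIES S2 ON THE TORUS, ADJOINT QUOTIENT (the divergence's summand).  Same letter; conclusion located at `blockOf y′ − e_μ`. [folklore] -/
theorem fit_bdiffN_blockMeanT (μ : Fin d) {η η' : ℝ} (hLη : (L : ℝ) * η' = η) {a' : Tor (fine L M) → ℝ} {θ₂ : Tor M → ℝ}
    (h : ∀ (b : Tor M) (z' : Tor (fine L M)), (blockOf L M z' = b ∨ blockOf L M z' = b + unitVec M μ) → ∀ ν : Fin d,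
      |fdiffN η' (fun y => y + unitVec (fine L M) μ) a' (z' + unitVec (fine L M) ν) -
        fdiffN η' (fun y => y + unitVec (fine L M) μ) a' z'| ≤ θ₂ b)
    (y' : Tor (fine L M)) :
    |bdiffN η' (Equiv.addRight (unitVec (fine L M) μ)) a' y' -
        bdiffN η (Equiv.addRight (unitVec M μ)) (blockMeanT L M a') (blockOf L M y')|
      ≤ ((d : ℝ) + 1) * ((L : ℝ) - 1) * θ₂ (blockOf L M y' - unitVec M μ) := by
  have hL : 0 < L := Nat.pos_of_ne_zero (NeZero.ne L)
  obtain ⟨x', rfl⟩ := qT_surjective (fine L M) y'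
  have hZ := slab_letter_of_torus L M μ h
  rw [← fdiffN_comp_qT] at hZ
  have key := fit_bdiffN_blockMean hL μ hLη (a' := a' ∘ qT (fine L M)) (θ₂ := θ₂ ∘ qT M) hZ x'
  rw [bdiffN_comp_qT, blockMean_comp_qT, bdiffN_comp_qT] at key
  simpa [blockOf_qT, qT_sub_unit] using key

/-- The torus in-block letter pulls back to part 12a's `InBlockBondBound` for the periodic field. [folklore] -/
theorem inBlockBondBound_of_torus {a' : Tor (fine L M) → ℝ} {θ₁ : Tor M → ℝ}
    (h : ∀ (y' : Tor (fine L M)) (ν : Fin d), blockOf L M (y' + unitVec (fine L M) ν) = blockOf L M y' →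
      |a' (y' + unitVec (fine L M) ν) - a' y'| ≤ θ₁ (blockOf L M y')) :
    InBlockBondBound L (a' ∘ qT (fine L M)) (θ₁ ∘ qT M) := by
  intro x ν hblk
  have hb : blockOf L M (qT (fine L M) x + unitVec (fine L M) ν) = blockOf L M (qT (fine L M) x) := by
    rw [← qT_add_unit, blockOf_qT, blockOf_qT, hblk]
  simpa [Function.comp_apply, qT_add_unit, blockOf_qT] using h (qT (fine L M) x) ν hb

/-- SPECIES S1 × TRANSPORTER ON THE TORUS: fine coefficient `phi1(η′, a′(y′))`, coarse `phi1(η, blockMeanT a′(blockOf y′))`; letters `|a′| ≤ r`,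
the in-block bond letter `θ₁`, regime `0 ≤ η′ ≤ η ≤ η₀`, `η₀r ≤ 1`: fit `≤ e·d(L−1)θ₁(blockOf y′) + 2r²η`. [folklore] -/
theorem fit_phi1_blockMeanT {η₀ r η η' : ℝ} (hreg : η₀ * r ≤ 1) (hη' : 0 ≤ η') (hη'η : η' ≤ η) (hη : η ≤ η₀)
    {a' : Tor (fine L M) → ℝ} (ha' : ∀ y', |a' y'| ≤ r) {θ₁ : Tor M → ℝ} (hθ : ∀ b, 0 ≤ θ₁ b)
    (h : ∀ (y' : Tor (fine L M)) (ν : Fin d), blockOf L M (y' + unitVec (fine L M) ν) = blockOf L M y' →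
      |a' (y' + unitVec (fine L M) ν) - a' y'| ≤ θ₁ (blockOf L M y'))
    (y' : Tor (fine L M)) :
    |phi1 η' (a' y') - phi1 η (blockMeanT L M a' (blockOf L M y'))| ≤
      Real.exp 1 * ((d : ℝ) * ((L : ℝ) - 1) * θ₁ (blockOf L M y')) + 2 * r ^ 2 * η := by
  have hL : 0 < L := Nat.pos_of_ne_zero (NeZero.ne L)
  obtain ⟨x', rfl⟩ := qT_surjective (fine L M) y'
  have key := fit_phi1_blockMean hL hreg hη' hη'η hη (a' := a' ∘ qT (fine L M)) (fun x => ha' _)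
    (θ₁ := θ₁ ∘ qT M) (fun y => hθ _) (inBlockBondBound_of_torus L M h) x'
  rw [blockMean_comp_qT] at key
  simpa [blockOf_qT] using key

/-- SPECIES S1 × `F′_{1,k}` ON THE TORUS: the same for `phi2` (letters `K = 2r`, `K′ = r³`): fit `≤ 2r·d(L−1)θ₁(blockOf y′) + 2r³η`. [folklore] -/
theorem fit_phi2_blockMeanT {η₀ r η η' : ℝ} (hreg : η₀ * r ≤ 1) (hr : 0 ≤ r) (hη' : 0 ≤ η') (hη'η : η' ≤ η) (hη : η ≤ η₀)
    {a' : Tor (fine L M) → ℝ} (ha' : ∀ y', |a' y'| ≤ r) {θ₁ : Tor M → ℝ} (hθ : ∀ b, 0 ≤ θ₁ b)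
    (h : ∀ (y' : Tor (fine L M)) (ν : Fin d), blockOf L M (y' + unitVec (fine L M) ν) = blockOf L M y' →
      |a' (y' + unitVec (fine L M) ν) - a' y'| ≤ θ₁ (blockOf L M y'))
    (y' : Tor (fine L M)) :
    |phi2 η' (a' y') - phi2 η (blockMeanT L M a' (blockOf L M y'))| ≤
      2 * r * ((d : ℝ) * ((L : ℝ) - 1) * θ₁ (blockOf L M y')) + 2 * r ^ 3 * η := by
  have hL : 0 < L := Nat.pos_of_ne_zero (NeZero.ne L)
  obtain ⟨x', rfl⟩ := qT_surjective (fine L M) y'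
  have key := fit_phi2_blockMean hL hreg hr hη' hη'η hη (a' := a' ∘ qT (fine L M)) (fun x => ha' _)
    (θ₁ := θ₁ ∘ qT M) (fun y => hθ _) (inBlockBondBound_of_torus L M h) x'
  rw [blockMean_comp_qT] at key
  simpa [blockOf_qT] using key

/-- (R3) SUP LETTER ON THE TORUS: `|a′| ≤ C` on the block ⟹ `|blockMeanT a′(b)| ≤ C`. [folklore] -/
theorem abs_blockMeanT_le {a' : Tor (fine L M) → ℝ} {b : Tor M} {C : ℝ} (h : ∀ j : Fin d → Fin L, |a' (site L M b j)| ≤ C) :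
    |blockMeanT L M a' b| ≤ C := by
  have hL : 0 < L := Nat.pos_of_ne_zero (NeZero.ne L)
  obtain ⟨y, rfl⟩ := qT_surjective M b
  have key := abs_blockMean_le hL (a' := a' ∘ qT (fine L M)) (y := y) (C := C) fun t ht => by
    rw [Function.comp_apply, qT_bpt L M y ht]; exact h _
  rw [blockMean_comp_qT] at key
  exact key

/-- (R3) GRADIENT LETTER ON THE TORUS ((3.35) shape, `Lη′ = η`): a bound `G` on `∇^{η′}_μ a′` on the window `{site b j + k e_μ : k < L}` gives the
SAME bound on `∇^η_μ(blockMeanT a′)(b)`. [folklore] -/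
theorem abs_fdiffN_blockMeanT_le (μ : Fin d) {η η' : ℝ} (hLη : (L : ℝ) * η' = η) {a' : Tor (fine L M) → ℝ} {b : Tor M} {G : ℝ}
    (h : ∀ (j : Fin d → Fin L) (k : ℕ), k < L →
      |fdiffN η' (fun y => y + unitVec (fine L M) μ) a' (site L M b j + Pi.single μ ((k : ℤ) : ZMod (fine L M μ)))| ≤ G) :
    |fdiffN η (fun c => c + unitVec M μ) (blockMeanT L M a') b| ≤ G := by
  have hL : 0 < L := Nat.pos_of_ne_zero (NeZero.ne L)
  obtain ⟨y, rfl⟩ := qT_surjective M b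
  have key := abs_fdiffN_blockMean_le hL hLη (a' := a' ∘ qT (fine L M)) μ (y := y) (G := G) fun t ht k hk => by
    rw [fdiffN_comp_qT, Function.comp_apply, qT_add_single, qT_bpt L M y ht]
    exact h _ k hk
  rw [blockMean_comp_qT, fdiffN_comp_qT] at key
  exact key

end Species

/-! ## §4 Dictionary to `kingLine`: the torus fits are `hfit` binders for `D := kingLine L M μ` -/

section KingLine

variable (L : ℕ) [NeZero L] (M : Fin d → ℕ) [hM : ∀ μ, NeZero (M μ)]

/-- The shifts and the block projection of `kingLine L M μ` ARE the torus translations and `blockOf` used above (by `rfl`), so a torus fit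
`|c′(y′) − c(blockOf y′)| ≤ o₀(blockOf y′)` dominated cube-wise (`o₀ b ≤ o (blk b)`) IS the binder
`hfit : ∀ y′, |c′ y′ − c (D.π y′)| ≤ o (blk (D.π y′))` of `N15.DerivDefect.hasMaj_coeffPiece` ∕ `hasMaj_comp_idef_zerothOrder_comp` at
`D := kingLine L M μ`. [folklore] -/
theorem hfit_kingLine_of_pointwise {S : Type*} (μ : Fin d) {c' : Tor (fine L M) → ℝ} {c : Tor M → ℝ} {o₀ : Tor M → ℝ}
    (hpt : ∀ y', |c' y' - c (blockOf L M y')| ≤ o₀ (blockOf L M y')) (blk : Tor M → S) {o : S → ℝ}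
    (hdom : ∀ b, o₀ b ≤ o (blk b)) :
    ∀ y', |c' y' - c ((kingLine L M μ).π y')| ≤ o (blk ((kingLine L M μ).π y')) :=
  fun y' => (hpt y').trans (hdom _)

/-- The fine shift of `kingLine` is the torus translation (so `fdiffN η′ (kingLine L M μ).s′ = fdiffN η′ (· + unitVec (fine L M) μ)` and
`bdiffN η′ (kingLine L M μ).s′ = bdiffN η′ (Equiv.addRight (unitVec (fine L M) μ))`), and its coarse shift is `· + unitVec M μ`. [folklore] -/
theorem kingLine_shifts (μ : Fin d) :
    ((kingLine L M μ).s' : Tor (fine L M) → Tor (fine L M)) = (fun y => y + unitVec (fine L M) μ) ∧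
      (kingLine L M μ).s' = Equiv.addRight (unitVec (fine L M) μ) ∧
      (kingLine L M μ).s = (fun b => b + unitVec M μ) ∧ (kingLine L M μ).π = blockOf L M :=
  ⟨funext fun y => kingLine_s' L M μ y, Equiv.ext fun y => kingLine_s' L M μ y, rfl, rfl⟩

end KingLine

end Summit.QuantumFields.YangMills.BalabanUVNodes.N15.CoefficientSpecies
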